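import Literature.NumberTheory.LFunctions.ZetaZeroTailSums
import HarnessLib

/-!
# Second differences of the explicit formula: `ψ(x) − x` bounded through `∑_{|Im ρ|≤T} m/|ρ|` and `∑_{|Im ρ|>T} m x^{β−1}/|Im ρ|³`

Topic: `Literature/NumberTheory/LFunctions`. THEOREMS (everything proved; no named fact is introduced).
Part of the discharge programme of `Literature.NumberTheory.LFunctions.RosserSchoenfeld1962_eq_3_22`
(Rosser–Schoenfeld 1962, Thm. 6 (3.22)). Rosser–Schoenfeld bound `ψ(x) − x` for large `x` (their
Table I, §6, Thms. 26–28) by the explicit formula integrated `m` times and differenced with a step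
`δx` (Rosser 1941, Lemmas 16–19; Rosser–Schoenfeld 1975, Lemma 8), the zeros below a height being on
the critical line by a numerical verification of RH and the others entering through
`R_m(δ)/δ^m · ∑ x^{β−1}/|γ|^{m+1}`. The tree has the case `m = 1` under the full Riemann hypothesis
(`SchoenfeldPsiDifference.lean`). This file proves the case **`m = 2` under RH up to a height `T`
only** (`RiemannHypothesisInStripUpTo T`, e.g. the tree's `platt_trudgian_numerical_rh`), which is
what an unconditional use requires: from the tree's absolutely convergent explicit formula for `ψ₁`
(`psiOne_eq_explicit`; `R₁(y) − R₁(x) = −Re(Z(y) − Z(x)) − (y − x) log 2π + (Re E(y) − Re E(x))`,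
`SchoenfeldBound.Rone_sub_Rone_eq`) and Landau's inequality `hψ(u) ≤ ψ₁(u+h) − ψ₁(u)` integrated over
`u ∈ [x, x+h]`:

* `sq_mul_psi_le` — `h²ψ(x) ≤ ∫_x^{x+h} (ψ₁(u+h) − ψ₁(u)) du` (`h > 0`);
* `integral_zeroTerm_shift_sub` — for one zero,
  `∫_x^{x+h} (zeroTerm ρ (u+h) − zeroTerm ρ u) du = m(ρ) Δ_h²[t^{ρ+2}](x)/(ρ(ρ+1)(ρ+2))`, and the two
  bounds `≤ m(ρ) h² (x+2h)^β/|ρ|` (`norm_integral_zeroTerm_shift_sub_le_low`, mean value twice) and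
  `≤ 4 m(ρ)(x+2h)^{β+2}/|Im ρ|³` (`norm_integral_zeroTerm_shift_sub_le_high`);
* `wTail T y = ∑_{|Im ρ| > T} m(ρ) y^{β−1}/|Im ρ|³` — the weighted cubic tail (`β = Re ρ`), with
  `wTail_le_tailInvImCube` (`≤ ∑_{|Im ρ|>T} m/|Im ρ|³`, as `β ≤ 1`) and, under RH up to `H ≥ T`,
  `wTail_le_of_inStripUpTo`: `wTail T y ≤ y^{−1/2} ∑_{|Im ρ|>T} m/|Im ρ|³ + wTail H y`;
* **`psi_sub_self_le`** — under RH up to height `T ≥ 1`, for `x > 1` and `h > 0`, with `y = x + 2h`: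
  `ψ(x) − x ≤ h − log 2π + √y · ∑_{|Im ρ| ≤ T} m(ρ)/|ρ| + (4y³/h²) · wTail T y + x/(2h(x² − 1))`.

With `h = r x` the last display is the `m = 2` line of Rosser–Schoenfeld's method:
`(ψ(x) − x)/x ≲ r + x^{−1/2} Σ₁(T) + 4(1+2r)³ r⁻² · ∑_{|γ|>T} m x^{β−1}/|γ|³`.

## References

* J. B. Rosser, L. Schoenfeld, Illinois J. Math. 6 (1962), 64–94, §6 (Thms. 26–28, Table I).
  [RosserSchoenfeld1962]
* J. B. Rosser, L. Schoenfeld, Math. Comp. 29 (1975), 243–269, Lemma 8. [RosserSchoenfeld1975]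
* L. Schoenfeld, Math. Comp. 30 (1976), 337–360, proof of Thm. 10. [Schoenfeld1976]
* H. L. Montgomery, R. C. Vaughan, *Multiplicative Number Theory I*, CUP 2007, (13.7). [MontgomeryVaughan2007]
-/

noncomputable section

open Complex Filter Set MeasureTheory Topology intervalIntegral
open scoped Real Chebyshev

namespace Literature.NumberTheory.LFunctions

namespace PsiSecondDifference

open NicolasJExplicit NicolasJ SchoenfeldBound PsiTailIntegral ZetaZeroTails

/-! ### Landau's inequality integrated: `h²ψ(x) ≤ ∫_x^{x+h} (ψ₁(u+h) − ψ₁(u)) du` -/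

/-- **`h² ψ(x) ≤ ∫_x^{x+h} (ψ₁(u+h) − ψ₁(u)) du`** for `h > 0` (`ψ₁(u+h) − ψ₁(u) ≥ hψ(u) ≥ hψ(x)` for
`u ≥ x`). [cite: RosserSchoenfeld1975, Lemma 8 (the differencing step, m = 2)] -/
theorem sq_mul_psi_le {x h : ℝ} (hh : 0 < h) :
    h ^ 2 * ψ x ≤ ∫ u in x..x + h, (psiOne (u + h) - psiOne u) := by
  have hxh : x ≤ x + h := by linarith
  have hcont : Continuous fun u : ℝ ↦ psiOne (u + h) - psiOne u :=
    (continuous_psiOne.comp ((continuous_id.add continuous_const))).sub continuous_psiOne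
  have hmono : ∫ u in x..x + h, h * ψ x ≤ ∫ u in x..x + h, (psiOne (u + h) - psiOne u) := by
    refine intervalIntegral.integral_mono_on hxh intervalIntegrable_const
      (hcont.intervalIntegrable _ _) fun u hu ↦ ?_
    have h1 := mul_psi_le_psiOne_sub (x := u) (y := u + h) (by linarith)
    have h2 : ψ x ≤ ψ u := Chebyshev.psi_mono hu.1
    rw [show u + h - u = h by ring] at h1
    nlinarith
  rw [intervalIntegral.integral_const, smul_eq_mul, show x + h - x = h by ring] at hmono
  nlinarith

/-! ### The explicit formula differenced and integrated -/

/-- `∫_x^{x+h} ((u+h)² − u²)/2 du = h²(x + h)`. [folklore] -/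
theorem integral_main_term (x h : ℝ) :
    ∫ u in x..x + h, ((u + h) ^ 2 - u ^ 2) / 2 = h ^ 2 * (x + h) := by
  have e : (fun u : ℝ ↦ ((u + h) ^ 2 - u ^ 2) / 2) = fun u ↦ h * u + h ^ 2 / 2 := by
    funext u; ring
  have hi : IntervalIntegrable (fun u : ℝ ↦ h * u) volume x (x + h) :=
    (continuous_const.mul continuous_id).intervalIntegrable _ _
  rw [e, intervalIntegral.integral_add hi intervalIntegrable_const, intervalIntegral.integral_const_mul,
    integral_id, intervalIntegral.integral_const, smul_eq_mul]
  ring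

/-- `Re(Z(u+h) − Z(u))` is continuous in `u` on `[x, x+h]`, `x ≥ 1`, `h ≥ 0`. [folklore] -/
theorem continuousOn_re_Zsum_shift_sub {x h : ℝ} (hx : 1 ≤ x) (hh : 0 ≤ h) :
    ContinuousOn (fun u : ℝ ↦ (Zsum (u + h) - Zsum u).re) (Icc x (x + h)) := by
  have h1 : ContinuousOn (fun u : ℝ ↦ Zsum (u + h)) (Icc x (x + h)) :=
    continuousOn_Zsum.comp ((continuous_id.add continuous_const)).continuousOn fun u hu ↦ by
      simp only [mem_Ici]; linarith [hu.1]
  have h2 : ContinuousOn Zsum (Icc x (x + h)) := continuousOn_Zsum.mono fun u hu ↦ hx.trans hu.1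
  exact Complex.continuous_re.comp_continuousOn (h1.sub h2)

/-- `Re E(u+h) − Re E(u)` is continuous in `u` on `[x, x+h]`, `x ≥ 1`, `h ≥ 0`. [folklore] -/
theorem continuousOn_re_psiOneRemainder_shift_sub {x h : ℝ} (hx : 1 ≤ x) (hh : 0 ≤ h) :
    ContinuousOn (fun u : ℝ ↦ (psiOneRemainder (u + h)).re - (psiOneRemainder u).re) (Icc x (x + h)) := by
  have h1 : ContinuousOn (fun u : ℝ ↦ psiOneRemainder (u + h)) (Icc x (x + h)) :=
    continuousOn_psiOneRemainder.comp ((continuous_id.add continuous_const)).continuousOn fun u hu ↦ by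
      simp only [mem_Ici]; linarith [hu.1]
  have h2 : ContinuousOn (fun u : ℝ ↦ psiOneRemainder u) (Icc x (x + h)) :=
    continuousOn_psiOneRemainder.mono fun u hu ↦ hx.trans hu.1
  exact (Complex.continuous_re.comp_continuousOn h1).sub (Complex.continuous_re.comp_continuousOn h2)

/-- **The second difference of `∫ψ₁`, through the explicit formula**: for `1 < x`, `0 < h`,
`∫_x^{x+h} (ψ₁(u+h) − ψ₁(u)) du = h²(x+h) − ∫_x^{x+h} Re(Z(u+h) − Z(u)) du − h² log 2π
  + ∫_x^{x+h} (Re E(u+h) − Re E(u)) du`. [cite: MontgomeryVaughan2007, (13.7)] -/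
theorem integral_psiOne_shift_sub_eq {x h : ℝ} (hx : 1 < x) (hh : 0 < h) :
    ∫ u in x..x + h, (psiOne (u + h) - psiOne u) =
      h ^ 2 * (x + h) - (∫ u in x..x + h, (Zsum (u + h) - Zsum u).re) - h ^ 2 * Real.log (2 * π) +
        ∫ u in x..x + h, ((psiOneRemainder (u + h)).re - (psiOneRemainder u).re) := by
  have hxh : x ≤ x + h := by linarith
  have hIcc : uIcc x (x + h) = Icc x (x + h) := uIcc_of_le hxh
  have hI0 : IntervalIntegrable (fun u : ℝ ↦ ((u + h) ^ 2 - u ^ 2) / 2) volume x (x + h) :=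
    (by fun_prop : Continuous fun u : ℝ ↦ ((u + h) ^ 2 - u ^ 2) / 2).intervalIntegrable _ _
  have hI1 : IntervalIntegrable (fun u : ℝ ↦ (Zsum (u + h) - Zsum u).re) volume x (x + h) := by
    refine ContinuousOn.intervalIntegrable ?_
    rw [hIcc]; exact continuousOn_re_Zsum_shift_sub hx.le hh.le
  have hI2 : IntervalIntegrable (fun _ : ℝ ↦ h * Real.log (2 * π)) volume x (x + h) :=
    intervalIntegrable_const
  have hI3 : IntervalIntegrable (fun u : ℝ ↦ (psiOneRemainder (u + h)).re - (psiOneRemainder u).re)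
      volume x (x + h) := by
    refine ContinuousOn.intervalIntegrable ?_
    rw [hIcc]; exact continuousOn_re_psiOneRemainder_shift_sub hx.le hh.le
  have hfun : EqOn (fun u : ℝ ↦ psiOne (u + h) - psiOne u)
      (fun u : ℝ ↦ ((u + h) ^ 2 - u ^ 2) / 2 - (Zsum (u + h) - Zsum u).re - h * Real.log (2 * π) +
        ((psiOneRemainder (u + h)).re - (psiOneRemainder u).re)) (uIcc x (x + h)) := by
    intro u hu
    rw [hIcc] at hu
    have hu1 : 1 ≤ u := hx.le.trans hu.1
    have hR := Rone_sub_Rone_eq hu1 (show u ≤ u + h by linarith)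
    simp only [Rone, show u + h - u = h by ring] at hR
    simp only
    linarith
  rw [integral_congr hfun, intervalIntegral.integral_add ((hI0.sub hI1).sub hI2) hI3,
    intervalIntegral.integral_sub (hI0.sub hI1) hI2, intervalIntegral.integral_sub hI0 hI1,
    integral_main_term, intervalIntegral.integral_const, smul_eq_mul]
  ring

/-- The trivial zeros' part is at most `h x/(2(x² − 1))`: for `1 < x`, `0 < h`,
`∫_x^{x+h} (Re E(u+h) − Re E(u)) du ≤ h · x/(2(x²−1))` (`0 ≤ Re E(u+h) − Re E(u) ≤ u/(2(u²−1)) ≤ x/(2(x²−1))`).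
[cite: MontgomeryVaughan2007, §12.1.1 Exercise 6] -/
theorem integral_re_psiOneRemainder_shift_sub_le {x h : ℝ} (hx : 1 < x) (hh : 0 < h) :
    ∫ u in x..x + h, ((psiOneRemainder (u + h)).re - (psiOneRemainder u).re) ≤
      h * (x / (2 * (x ^ 2 - 1))) := by
  have hxh : x ≤ x + h := by linarith
  have hI3 : IntervalIntegrable (fun u : ℝ ↦ (psiOneRemainder (u + h)).re - (psiOneRemainder u).re)
      volume x (x + h) := by
    refine ContinuousOn.intervalIntegrable ?_
    rw [uIcc_of_le hxh]; exact continuousOn_re_psiOneRemainder_shift_sub hx.le hh.le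
  have hmono : ∫ u in x..x + h, ((psiOneRemainder (u + h)).re - (psiOneRemainder u).re) ≤
      ∫ u in x..x + h, x / (2 * (x ^ 2 - 1)) := by
    refine intervalIntegral.integral_mono_on hxh hI3 intervalIntegrable_const fun u hu' ↦ ?_
    have hux : x ≤ u := hu'.1
    have hu : 1 < u := hx.trans_le hux
    have h1 := (re_psiOneRemainder_sub_mem hu (show u ≤ u + h by linarith)).2
    -- `u/(2(u²−1)) ≤ x/(2(x²−1))` for `u ≥ x > 1`
    have hx21 : 0 < x ^ 2 - 1 := by nlinarith
    have hu21 : 0 < u ^ 2 - 1 := by nlinarith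
    have h2 : u / (2 * (u ^ 2 - 1)) ≤ x / (2 * (x ^ 2 - 1)) := by
      rw [div_le_div_iff₀ (by positivity) (by positivity)]
      nlinarith [mul_nonneg (sub_nonneg.2 hux) (by nlinarith : 0 ≤ u * x + 1)]
    exact h1.trans h2
  rw [intervalIntegral.integral_const, smul_eq_mul, show x + h - x = h by ring] at hmono
  exact hmono

/-! ### One zero: the integrated difference and its two bounds -/

/-- **Exact form**: for real `x`, `h`,
`∫_x^{x+h} (zeroTerm ρ (u+h) − zeroTerm ρ u) du
  = m(ρ)((x+2h)^{ρ+2} − 2(x+h)^{ρ+2} + x^{ρ+2})/(ρ(ρ+1)(ρ+2))`. [cite: RosserSchoenfeld1975, Lemma 8] -/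
theorem integral_zeroTerm_shift_sub (x h : ℝ) (ρ : Zeros) :
    ∫ u in x..x + h, (zeroTerm ρ (u + h) - zeroTerm ρ u) =
      (riemannZetaZeroOrder (ρ : ℂ) : ℂ) *
        ((((x + 2 * h : ℝ) : ℂ) ^ ((ρ : ℂ) + 2) - 2 * ((x + h : ℝ) : ℂ) ^ ((ρ : ℂ) + 2) +
          (x : ℂ) ^ ((ρ : ℂ) + 2)) / ((ρ : ℂ) * (ρ + 1) * (ρ + 2))) := by
  have hρ0 := ne_zero ρ.2
  have hρ1 := add_one_ne_zero ρ.2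
  have hρ2 : (ρ : ℂ) + 2 ≠ 0 := by
    intro h0
    have := re_pos ρ.2
    have h1 : ((ρ : ℂ) + 2).re = 0 := by rw [h0]; simp
    simp at h1; linarith
  have hre : -1 < ((ρ : ℂ) + 1).re := by rw [add_re, one_re]; linarith [re_pos ρ.2]
  -- integrability of `zeroTerm ρ` on any interval
  have hc : Continuous fun t : ℝ ↦ zeroTerm ρ t :=
    continuous_const.mul ((continuous_ofReal_cpow_const (by rw [add_re, one_re]; linarith [re_pos ρ.2])).div_const _)
  have hcp : ∀ a b : ℝ, ∫ t in a..b, zeroTerm ρ t =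
      (riemannZetaZeroOrder (ρ : ℂ) : ℂ) * (((b : ℂ) ^ ((ρ : ℂ) + 2) - (a : ℂ) ^ ((ρ : ℂ) + 2)) /
        ((ρ : ℂ) * (ρ + 1) * (ρ + 2))) := by
    intro a b
    have h := integral_cpow (a := a) (b := b) (r := (ρ : ℂ) + 1) (Or.inl hre)
    rw [show (ρ : ℂ) + 1 + 1 = (ρ : ℂ) + 2 by ring] at h
    simp only [zeroTerm]
    rw [intervalIntegral.integral_const_mul, intervalIntegral.integral_div, h]
    field_simp
  have hi1 : IntervalIntegrable (fun u : ℝ ↦ zeroTerm ρ (u + h)) volume x (x + h) :=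
    (hc.comp (continuous_id.add continuous_const)).intervalIntegrable _ _
  have hi2 : IntervalIntegrable (fun u : ℝ ↦ zeroTerm ρ u) volume x (x + h) := hc.intervalIntegrable _ _
  have hshift : ∫ u in x..x + h, zeroTerm ρ (u + h) = ∫ t in x + h..x + h + h, zeroTerm ρ t :=
    intervalIntegral.integral_comp_add_right (zeroTerm ρ) h
  rw [intervalIntegral.integral_sub hi1 hi2, hshift, hcp, hcp, show x + h + h = x + 2 * h by ring]
  push_cast
  field_simp
  ring

/-- `|t^{z}| ≤ y^{Re z}` for `0 < t ≤ y` and `Re z ≥ 0`. [folklore] -/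
theorem norm_cpow_le {t y : ℝ} (ht : 0 < t) (hty : t ≤ y) {z : ℂ} (hz : 0 ≤ z.re) :
    ‖(t : ℂ) ^ z‖ ≤ y ^ z.re := by
  rw [Complex.norm_cpow_eq_rpow_re_of_pos ht]
  exact Real.rpow_le_rpow ht.le hty hz

/-- **High zeros**: for `0 < x`, `0 ≤ h`,
`‖∫_x^{x+h} (zeroTerm ρ (u+h) − zeroTerm ρ u) du‖ ≤ 4 m(ρ)(x+2h)^{β+2}/|Im ρ|³` (each of the four
powers has modulus `≤ (x+2h)^{β+2}`, and `|ρ|, |ρ+1|, |ρ+2| ≥ |Im ρ|`). [cite: RosserSchoenfeld1975, Lemma 8] -/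
theorem norm_integral_zeroTerm_shift_sub_le_high {x h : ℝ} (hx : 0 < x) (hh : 0 ≤ h) (ρ : Zeros)
    (hγ : 0 < |(ρ : ℂ).im|) :
    ‖∫ u in x..x + h, (zeroTerm ρ (u + h) - zeroTerm ρ u)‖ ≤
      4 * (riemannZetaZeroOrder (ρ : ℂ) : ℝ) * (x + 2 * h) ^ ((ρ : ℂ).re + 2) / |(ρ : ℂ).im| ^ 3 := by
  have hm := zeroOrder_nonneg' ρ
  have hβ := re_pos ρ.2
  set y : ℝ := x + 2 * h with hy
  have hxy : x ≤ y := by rw [hy]; linarith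
  have hxhy : x + h ≤ y := by rw [hy]; linarith
  have hy0 : 0 < y := hx.trans_le hxy
  have hre2 : ((ρ : ℂ) + 2).re = (ρ : ℂ).re + 2 := by simp
  have hz : 0 ≤ ((ρ : ℂ) + 2).re := by rw [hre2]; linarith
  rw [integral_zeroTerm_shift_sub x h ρ, norm_mul, Complex.norm_intCast, abs_of_nonneg hm, norm_div]
  -- numerator
  have hnum : ‖((y : ℂ)) ^ ((ρ : ℂ) + 2) - 2 * ((x + h : ℝ) : ℂ) ^ ((ρ : ℂ) + 2) + (x : ℂ) ^ ((ρ : ℂ) + 2)‖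
      ≤ 4 * y ^ ((ρ : ℂ).re + 2) := by
    have h1 := norm_cpow_le hy0 le_rfl hz
    have h2 := norm_cpow_le (hx.trans_le (by linarith : x ≤ x + h)) hxhy hz
    have h3 := norm_cpow_le hx hxy hz
    rw [hre2] at h1 h2 h3
    calc ‖((y : ℂ)) ^ ((ρ : ℂ) + 2) - 2 * ((x + h : ℝ) : ℂ) ^ ((ρ : ℂ) + 2) + (x : ℂ) ^ ((ρ : ℂ) + 2)‖
        ≤ ‖((y : ℂ)) ^ ((ρ : ℂ) + 2)‖ + ‖2 * ((x + h : ℝ) : ℂ) ^ ((ρ : ℂ) + 2)‖ + ‖(x : ℂ) ^ ((ρ : ℂ) + 2)‖ :=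
          (norm_add_le _ _).trans (add_le_add (norm_sub_le _ _) le_rfl)
      _ ≤ y ^ ((ρ : ℂ).re + 2) + 2 * y ^ ((ρ : ℂ).re + 2) + y ^ ((ρ : ℂ).re + 2) := by
          rw [norm_mul, Complex.norm_ofNat]; gcongr
      _ = 4 * y ^ ((ρ : ℂ).re + 2) := by ring
  -- denominator
  have hden : |(ρ : ℂ).im| ^ 3 ≤ ‖(ρ : ℂ) * (ρ + 1) * (ρ + 2)‖ := by
    rw [norm_mul, norm_mul]
    have a := Complex.abs_im_le_norm (ρ : ℂ)
    have b : |(ρ : ℂ).im| ≤ ‖(ρ : ℂ) + 1‖ := by simpa using Complex.abs_im_le_norm ((ρ : ℂ) + 1)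
    have c : |(ρ : ℂ).im| ≤ ‖(ρ : ℂ) + 2‖ := by simpa using Complex.abs_im_le_norm ((ρ : ℂ) + 2)
    calc |(ρ : ℂ).im| ^ 3 = |(ρ : ℂ).im| * |(ρ : ℂ).im| * |(ρ : ℂ).im| := by ring
      _ ≤ ‖(ρ : ℂ)‖ * ‖(ρ : ℂ) + 1‖ * ‖(ρ : ℂ) + 2‖ := by gcongr
  have hden0 : 0 < |(ρ : ℂ).im| ^ 3 := pow_pos hγ 3
  rw [hy] at hnum ⊢
  calc (riemannZetaZeroOrder (ρ : ℂ) : ℝ) *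
        (‖((x + 2 * h : ℝ) : ℂ) ^ ((ρ : ℂ) + 2) - 2 * ((x + h : ℝ) : ℂ) ^ ((ρ : ℂ) + 2) + (x : ℂ) ^ ((ρ : ℂ) + 2)‖ /
          ‖(ρ : ℂ) * (ρ + 1) * (ρ + 2)‖)
      ≤ (riemannZetaZeroOrder (ρ : ℂ) : ℝ) * (4 * (x + 2 * h) ^ ((ρ : ℂ).re + 2) / |(ρ : ℂ).im| ^ 3) := by
        refine mul_le_mul_of_nonneg_left ?_ hm
        exact div_le_div₀ (by positivity) hnum hden0 hden
    _ = 4 * (riemannZetaZeroOrder (ρ : ℂ) : ℝ) * (x + 2 * h) ^ ((ρ : ℂ).re + 2) / |(ρ : ℂ).im| ^ 3 := by ring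

/-- **Low zeros** (mean value twice): for `0 < x`, `0 ≤ h` and `u ∈ [x, x+h]`,
`‖zeroTerm ρ (u+h) − zeroTerm ρ u‖ ≤ m(ρ) h (x+2h)^β/|ρ|`
(`(u+h)^{ρ+1} − u^{ρ+1} = (ρ+1)∫_u^{u+h} v^ρ dv`). [cite: RosserSchoenfeld1975, Lemma 8] -/
theorem norm_zeroTerm_shift_sub_le {x h u : ℝ} (hx : 0 < x) (hh : 0 ≤ h) (hu : u ∈ Icc x (x + h)) (ρ : Zeros) :
    ‖zeroTerm ρ (u + h) - zeroTerm ρ u‖ ≤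
      (riemannZetaZeroOrder (ρ : ℂ) : ℝ) * h * (x + 2 * h) ^ (ρ : ℂ).re / ‖(ρ : ℂ)‖ := by
  have hm := zeroOrder_nonneg' ρ
  have hβ := re_pos ρ.2
  have hρ0 : (ρ : ℂ) ≠ 0 := ne_zero ρ.2
  have hρ1 : (ρ : ℂ) + 1 ≠ 0 := add_one_ne_zero ρ.2
  have hu0 : 0 < u := hx.trans_le hu.1
  have huh : u ≤ u + h := by linarith
  have hint : ∫ t in u..u + h, (t : ℂ) ^ (ρ : ℂ) =
      (((u + h : ℝ) : ℂ) ^ ((ρ : ℂ) + 1) - (u : ℂ) ^ ((ρ : ℂ) + 1)) / ((ρ : ℂ) + 1) :=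
    integral_cpow (a := u) (b := u + h) (r := (ρ : ℂ)) (Or.inl (by linarith))
  have hdiff : zeroTerm ρ (u + h) - zeroTerm ρ u =
      (riemannZetaZeroOrder (ρ : ℂ) : ℂ) * ((∫ t in u..u + h, (t : ℂ) ^ (ρ : ℂ)) / (ρ : ℂ)) := by
    rw [hint, zeroTerm, zeroTerm]
    push_cast
    field_simp
  have hbound : ‖∫ t in u..u + h, (t : ℂ) ^ (ρ : ℂ)‖ ≤ (x + 2 * h) ^ (ρ : ℂ).re * |u + h - u| := by
    refine intervalIntegral.norm_integral_le_of_norm_le_const fun t ht ↦ ?_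
    rw [Set.uIoc_of_le huh] at ht
    have ht0 : 0 < t := hu0.trans ht.1
    exact norm_cpow_le ht0 (by linarith [ht.2, hu.2]) hβ.le
  rw [show u + h - u = h by ring, abs_of_nonneg hh] at hbound
  rw [hdiff, norm_mul, Complex.norm_intCast, abs_of_nonneg hm, norm_div]
  have key : ‖∫ t in u..u + h, (t : ℂ) ^ (ρ : ℂ)‖ / ‖(ρ : ℂ)‖ ≤ h * (x + 2 * h) ^ (ρ : ℂ).re / ‖(ρ : ℂ)‖ :=
    div_le_div_of_nonneg_right (by linarith) (norm_nonneg _)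
  calc (riemannZetaZeroOrder (ρ : ℂ) : ℝ) * (‖∫ t in u..u + h, (t : ℂ) ^ (ρ : ℂ)‖ / ‖(ρ : ℂ)‖)
      ≤ (riemannZetaZeroOrder (ρ : ℂ) : ℝ) * (h * (x + 2 * h) ^ (ρ : ℂ).re / ‖(ρ : ℂ)‖) :=
        mul_le_mul_of_nonneg_left key hm
    _ = (riemannZetaZeroOrder (ρ : ℂ) : ℝ) * h * (x + 2 * h) ^ (ρ : ℂ).re / ‖(ρ : ℂ)‖ := by ring

/-- **Low zeros, integrated**: for `0 < x`, `0 ≤ h`,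
`‖∫_x^{x+h} (zeroTerm ρ (u+h) − zeroTerm ρ u) du‖ ≤ m(ρ) h² (x+2h)^β/|ρ|`. [cite: RosserSchoenfeld1975, Lemma 8] -/
theorem norm_integral_zeroTerm_shift_sub_le_low {x h : ℝ} (hx : 0 < x) (hh : 0 ≤ h) (ρ : Zeros) :
    ‖∫ u in x..x + h, (zeroTerm ρ (u + h) - zeroTerm ρ u)‖ ≤
      (riemannZetaZeroOrder (ρ : ℂ) : ℝ) * h ^ 2 * (x + 2 * h) ^ (ρ : ℂ).re / ‖(ρ : ℂ)‖ := by
  have hxh : x ≤ x + h := by linarith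
  have hI := intervalIntegral.norm_integral_le_of_norm_le_const (a := x) (b := x + h)
    (f := fun u ↦ zeroTerm ρ (u + h) - zeroTerm ρ u)
    (C := (riemannZetaZeroOrder (ρ : ℂ) : ℝ) * h * (x + 2 * h) ^ (ρ : ℂ).re / ‖(ρ : ℂ)‖) fun u hu ↦ by
      rw [Set.uIoc_of_le hxh] at hu
      exact norm_zeroTerm_shift_sub_le hx hh ⟨hu.1.le, hu.2⟩ ρ
  rw [show x + h - x = h by ring, abs_of_nonneg hh] at hI
  calc _ ≤ _ := hI
    _ = _ := by ring


/-! ### The weighted cubic tail `∑_{|Im ρ| > T} m(ρ) y^{β−1}/|Im ρ|³` -/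

/-- `wTail T y = ∑_{|Im ρ| > T} m(ρ) y^{β−1}/|Im ρ|³` (`β = Re ρ`): the high zeros' contribution to the
second difference, Rosser–Schoenfeld's `∑ x^{β−1} φ_m(γ)` with `m = 2`.
[cite: RosserSchoenfeld1962, §6 (6.1)] -/
def wTail (T y : ℝ) : ℝ :=
  ∑' ρ : Zeros, if ρ ∈ zerosUpTo T then 0 else
    (riemannZetaZeroOrder (ρ : ℂ) : ℝ) * y ^ ((ρ : ℂ).re - 1) / |(ρ : ℂ).im| ^ 3

/-- Termwise comparison with the unweighted cubic tail (`y^{β−1} ≤ 1` for `y ≥ 1`). [folklore] -/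
theorem wTail_term_le {T y : ℝ} (hy : 1 ≤ y) (ρ : Zeros) :
    (if ρ ∈ zerosUpTo T then (0 : ℝ) else
      (riemannZetaZeroOrder (ρ : ℂ) : ℝ) * y ^ ((ρ : ℂ).re - 1) / |(ρ : ℂ).im| ^ 3) ≤
    (if ρ ∈ zerosUpTo T then (0 : ℝ) else (riemannZetaZeroOrder (ρ : ℂ) : ℝ) / |(ρ : ℂ).im| ^ 3) := by
  split_ifs
  · exact le_rfl
  · have hm := zeroOrder_nonneg' ρ
    have h1 : y ^ ((ρ : ℂ).re - 1) ≤ 1 :=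
      Real.rpow_le_one_of_one_le_of_nonpos hy (by linarith [re_lt_one ρ.2])
    refine div_le_div_of_nonneg_right ?_ (pow_nonneg (abs_nonneg _) 3)
    nlinarith

/-- The terms of `wTail` are non-negative. [folklore] -/
theorem wTail_term_nonneg {T y : ℝ} (hy : 0 ≤ y) (ρ : Zeros) :
    0 ≤ (if ρ ∈ zerosUpTo T then (0 : ℝ) else
      (riemannZetaZeroOrder (ρ : ℂ) : ℝ) * y ^ ((ρ : ℂ).re - 1) / |(ρ : ℂ).im| ^ 3) := by
  split_ifs
  · exact le_rfl
  · exact div_nonneg (mul_nonneg (zeroOrder_nonneg' ρ) (Real.rpow_nonneg hy _)) (pow_nonneg (abs_nonneg _) 3)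

/-- `wTail T y` converges (`T ≥ 1`, `y ≥ 1`). [folklore] -/
theorem summable_wTail {T y : ℝ} (hT : 1 ≤ T) (hy : 1 ≤ y) :
    Summable fun ρ : Zeros ↦ if ρ ∈ zerosUpTo T then (0 : ℝ) else
      (riemannZetaZeroOrder (ρ : ℂ) : ℝ) * y ^ ((ρ : ℂ).re - 1) / |(ρ : ℂ).im| ^ 3 :=
  Summable.of_nonneg_of_le (wTail_term_nonneg (by linarith)) (wTail_term_le hy) (summable_tailInvImCube hT)

/-- `wTail T y ≥ 0` (`y ≥ 0`). [folklore] -/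
theorem wTail_nonneg {T y : ℝ} (hy : 0 ≤ y) : 0 ≤ wTail T y := tsum_nonneg (wTail_term_nonneg hy)

/-- **`wTail T y ≤ ∑_{|Im ρ| > T} m(ρ)/|Im ρ|³`** (`T ≥ 1`, `y ≥ 1`; `β ≤ 1`). [folklore] -/
theorem wTail_le_tailInvImCube {T y : ℝ} (hT : 1 ≤ T) (hy : 1 ≤ y) : wTail T y ≤ tailInvImCube T :=
  (summable_wTail hT hy).tsum_le_tsum (wTail_term_le hy) (summable_tailInvImCube hT)

/-- **Splitting the weighted tail at a verified height**: under RH up to height `H`, for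
`1 ≤ T ≤ H` and `y ≥ 1`,
`wTail T y ≤ y^{−1/2} · ∑_{|Im ρ| > T} m(ρ)/|Im ρ|³ + wTail H y`
(the zeros with `T < |Im ρ| ≤ H` have `y^{β−1} = y^{−1/2}`). [cite: RosserSchoenfeld1962, §6] -/
theorem wTail_le_of_inStripUpTo {T H y : ℝ} (hRH : RiemannHypothesisInStripUpTo H) (hT : 1 ≤ T)
    (hTH : T ≤ H) (hy : 1 ≤ y) :
    wTail T y ≤ y ^ (-(1 / 2 : ℝ)) * tailInvImCube T + wTail H y := by
  classical
  have hH : 1 ≤ H := hT.trans hTH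
  have hy0 : 0 < y := by linarith
  set c : Zeros → ℝ := fun ρ ↦ if ρ ∈ zerosUpTo T then (0 : ℝ) else
      (riemannZetaZeroOrder (ρ : ℂ) : ℝ) / |(ρ : ℂ).im| ^ 3 with hc
  set fH : Zeros → ℝ := fun ρ ↦ if ρ ∈ zerosUpTo H then (0 : ℝ) else
      (riemannZetaZeroOrder (ρ : ℂ) : ℝ) * y ^ ((ρ : ℂ).re - 1) / |(ρ : ℂ).im| ^ 3 with hfH
  have h₁ : HasSum (fun ρ ↦ y ^ (-(1 / 2 : ℝ)) * c ρ) (y ^ (-(1 / 2 : ℝ)) * tailInvImCube T) :=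
    (summable_tailInvImCube hT).hasSum.mul_left _
  have h₂ : HasSum fH (wTail H y) := (summable_wTail hH hy).hasSum
  refine hasSum_le (fun ρ ↦ ?_) (summable_wTail hT hy).hasSum (h₁.add h₂)
  have hm := zeroOrder_nonneg' ρ
  have hc0 : 0 ≤ c ρ := by
    simp only [hc]; split_ifs
    · exact le_rfl
    · exact div_nonneg hm (pow_nonneg (abs_nonneg _) 3)
  have hf0 : 0 ≤ fH ρ := wTail_term_nonneg hy0.le ρ
  have hyr : 0 ≤ y ^ (-(1 / 2 : ℝ)) := Real.rpow_nonneg hy0.le _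
  by_cases hρT : ρ ∈ zerosUpTo T
  · rw [if_pos hρT]; positivity
  · rw [if_neg hρT]
    by_cases hρH : ρ ∈ zerosUpTo H
    · -- on the critical line
      have hre := re_eq_half_of_inStripUpTo hRH hρH
      simp only [hc, hfH]
      rw [if_neg hρT, if_pos hρH, add_zero, hre, show (1 / 2 - 1 : ℝ) = -(1 / 2) by norm_num]
      apply le_of_eq; ring
    · simp only [hc, hfH]
      rw [if_neg hρT, if_neg hρH]
      have : 0 ≤ y ^ (-(1 / 2 : ℝ)) * ((riemannZetaZeroOrder (ρ : ℂ) : ℝ) / |(ρ : ℂ).im| ^ 3) :=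
        mul_nonneg hyr (div_nonneg hm (pow_nonneg (abs_nonneg _) 3))
      linarith

/-! ### The differenced zero sum, integrated: dominated convergence -/

/-- `u ↦ zeroTerm ρ (u+h) − zeroTerm ρ u` is continuous. [folklore] -/
theorem continuous_zeroTerm_shift_sub (ρ : Zeros) (h : ℝ) :
    Continuous fun u : ℝ ↦ zeroTerm ρ (u + h) - zeroTerm ρ u := by
  have hc : Continuous fun t : ℝ ↦ zeroTerm ρ t :=
    continuous_const.mul ((continuous_ofReal_cpow_const (by rw [add_re, one_re]; linarith [re_pos ρ.2])).div_const _)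
  exact (hc.comp (continuous_id.add continuous_const)).sub hc

/-- On `(x, x+h]`, `x ≥ 1`, `h ≥ 0`: `‖zeroTerm ρ (u+h) − zeroTerm ρ u‖ ≤ 2(x+2h)² ‖zeroTerm ρ 1‖`. [folklore] -/
theorem norm_zeroTerm_shift_sub_le_crude {x h u : ℝ} (hx : 1 ≤ x) (hh : 0 ≤ h) (hu : u ∈ Ioc x (x + h))
    (ρ : Zeros) : ‖zeroTerm ρ (u + h) - zeroTerm ρ u‖ ≤ 2 * (x + 2 * h) ^ 2 * ‖zeroTerm ρ 1‖ := by
  have h1 := norm_zeroTerm_le_sq_mul ρ (X := x + 2 * h) (t := u + h) ⟨by linarith [hu.1], by linarith [hu.2]⟩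
  have h2 := norm_zeroTerm_le_sq_mul ρ (X := x + 2 * h) (t := u) ⟨hx.trans hu.1.le, by linarith [hu.2]⟩
  calc ‖zeroTerm ρ (u + h) - zeroTerm ρ u‖ ≤ ‖zeroTerm ρ (u + h)‖ + ‖zeroTerm ρ u‖ := norm_sub_le _ _
    _ ≤ _ := by linarith

/-- **`∫_x^{x+h} (Z(u+h) − Z(u)) du = ∑_ρ ∫_x^{x+h} (zeroTerm ρ (u+h) − zeroTerm ρ u) du`**, the series of
integrals converging absolutely (`1 ≤ x`, `0 ≤ h`). [folklore] -/
theorem hasSum_integral_zeroTerm_shift_sub {x h : ℝ} (hx : 1 ≤ x) (hh : 0 ≤ h) :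
    HasSum (fun ρ : Zeros ↦ ∫ u in x..x + h, (zeroTerm ρ (u + h) - zeroTerm ρ u))
      (∫ u in x..x + h, (Zsum (u + h) - Zsum u)) ∧
    Summable fun ρ : Zeros ↦ ‖∫ u in x..x + h, (zeroTerm ρ (u + h) - zeroTerm ρ u)‖ := by
  have hxh : x ≤ x + h := by linarith
  have hbound : Summable fun ρ : Zeros ↦ h * (2 * (x + 2 * h) ^ 2 * ‖zeroTerm ρ 1‖) :=
    (((summable_norm_psiOne_zeroTerm le_rfl).mul_left (2 * (x + 2 * h) ^ 2))).mul_left h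
  have hint : ∀ ρ : Zeros, IntegrableOn (fun u : ℝ ↦ zeroTerm ρ (u + h) - zeroTerm ρ u) (Ioc x (x + h)) :=
    fun ρ ↦ (continuous_zeroTerm_shift_sub ρ h).integrableOn_Icc.mono_set Ioc_subset_Icc_self
  have hnorm_le : ∀ ρ : Zeros, ∫ u in Ioc x (x + h), ‖zeroTerm ρ (u + h) - zeroTerm ρ u‖ ≤
      h * (2 * (x + 2 * h) ^ 2 * ‖zeroTerm ρ 1‖) := by
    intro ρ
    calc ∫ u in Ioc x (x + h), ‖zeroTerm ρ (u + h) - zeroTerm ρ u‖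
        ≤ ∫ u in Ioc x (x + h), 2 * (x + 2 * h) ^ 2 * ‖zeroTerm ρ 1‖ := by
          refine setIntegral_mono_on (hint ρ).norm (integrableOn_const (by simp)) measurableSet_Ioc
            fun u hu ↦ norm_zeroTerm_shift_sub_le_crude hx hh hu ρ
      _ = h * (2 * (x + 2 * h) ^ 2 * ‖zeroTerm ρ 1‖) := by
          rw [setIntegral_const, Real.volume_real_Ioc_of_le hxh, smul_eq_mul, show x + h - x = h by ring]
  have hnorm : Summable fun ρ : Zeros ↦ ∫ u in Ioc x (x + h), ‖zeroTerm ρ (u + h) - zeroTerm ρ u‖ :=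
    Summable.of_nonneg_of_le (fun ρ ↦ integral_nonneg fun u ↦ norm_nonneg _) hnorm_le hbound
  have hF := integral_tsum_of_summable_integral_norm (μ := volume.restrict (Ioc x (x + h)))
    (F := fun (ρ : Zeros) (u : ℝ) ↦ zeroTerm ρ (u + h) - zeroTerm ρ u) hint hnorm
  have hsum : Summable fun ρ : Zeros ↦ ‖∫ u in x..x + h, (zeroTerm ρ (u + h) - zeroTerm ρ u)‖ := by
    refine Summable.of_nonneg_of_le (fun _ ↦ norm_nonneg _) (fun ρ ↦ ?_) hnorm
    rw [intervalIntegral.integral_of_le hxh]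
    exact norm_integral_le_integral_norm _
  refine ⟨?_, hsum⟩
  have heq : ∫ u in x..x + h, (Zsum (u + h) - Zsum u) =
      ∑' ρ : Zeros, ∫ u in x..x + h, (zeroTerm ρ (u + h) - zeroTerm ρ u) := by
    simp_rw [intervalIntegral.integral_of_le hxh]
    rw [hF]
    refine setIntegral_congr_fun measurableSet_Ioc fun u hu ↦ ?_
    simp only [Zsum]
    exact ((summable_zeroTerm (by linarith [hu.1] : (1 : ℝ) ≤ u + h)).tsum_sub
      (summable_zeroTerm (hx.trans hu.1.le))).symm
  rw [heq]
  exact hsum.of_norm.hasSum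

/-- **The differenced zero sum, bounded**: under RH up to height `T ≥ 1`, for `1 ≤ x`, `0 < h`,
with `y = x + 2h`:
`‖∫_x^{x+h} (Z(u+h) − Z(u)) du‖ ≤ h²√y · ∑_{|Im ρ| ≤ T} m(ρ)/|ρ| + 4y³ · wTail T y`.
[cite: RosserSchoenfeld1975, Lemma 8 (m = 2)] -/
theorem norm_integral_Zsum_shift_sub_le {T x h : ℝ} (hRH : RiemannHypothesisInStripUpTo T)
    (hT : 1 ≤ T) (hx : 1 ≤ x) (hh : 0 < h) :
    ‖∫ u in x..x + h, (Zsum (u + h) - Zsum u)‖ ≤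
      h ^ 2 * Real.sqrt (x + 2 * h) * sumInvNorm T + 4 * (x + 2 * h) ^ 3 * wTail T (x + 2 * h) := by
  classical
  have hx0 : 0 < x := by linarith
  set y : ℝ := x + 2 * h with hy
  have hy1 : 1 ≤ y := by rw [hy]; linarith
  have hy0 : 0 < y := by linarith
  obtain ⟨hsum, hnorm⟩ := hasSum_integral_zeroTerm_shift_sub hx hh.le
  set g₁ : Zeros → ℝ := fun ρ ↦ if ρ ∈ zerosUpTo T then
      h ^ 2 * Real.sqrt y * ((riemannZetaZeroOrder (ρ : ℂ) : ℝ) / ‖(ρ : ℂ)‖) else 0 with hg₁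
  set g₂ : Zeros → ℝ := fun ρ ↦ 4 * y ^ 3 * (if ρ ∈ zerosUpTo T then (0 : ℝ) else
      (riemannZetaZeroOrder (ρ : ℂ) : ℝ) * y ^ ((ρ : ℂ).re - 1) / |(ρ : ℂ).im| ^ 3) with hg₂
  have h₁ : HasSum g₁ (h ^ 2 * Real.sqrt y * sumInvNorm T) := by
    have hg : HasSum g₁ (∑ ρ ∈ zerosUpTo T, g₁ ρ) :=
      hasSum_sum_of_ne_finset_zero (fun ρ hρ ↦ by simp only [hg₁]; rw [if_neg hρ])
    have hs : ∑ ρ ∈ zerosUpTo T, g₁ ρ = h ^ 2 * Real.sqrt y * sumInvNorm T := by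
      rw [sumInvNorm, Finset.mul_sum]
      refine Finset.sum_congr rfl fun ρ hρ ↦ ?_
      simp only [hg₁]; rw [if_pos hρ]
    rwa [hs] at hg
  have h₂ : HasSum g₂ (4 * y ^ 3 * wTail T y) := (summable_wTail hT hy1).hasSum.mul_left _
  have hmaj : ∀ ρ : Zeros, ‖∫ u in x..x + h, (zeroTerm ρ (u + h) - zeroTerm ρ u)‖ ≤ g₁ ρ + g₂ ρ := by
    intro ρ
    have hm := zeroOrder_nonneg' ρ
    by_cases hρ : ρ ∈ zerosUpTo T
    · simp only [hg₁, hg₂]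
      rw [if_pos hρ, if_pos hρ, mul_zero, add_zero]
      have hb := norm_integral_zeroTerm_shift_sub_le_low hx0 hh.le ρ
      have hre := re_eq_half_of_inStripUpTo hRH hρ
      rw [hre, ← hy, ← Real.sqrt_eq_rpow] at hb
      calc _ ≤ _ := hb
        _ = _ := by ring
    · simp only [hg₁, hg₂]
      rw [if_neg hρ, if_neg hρ, zero_add]
      obtain ⟨hγT, -, -⟩ := aux_of_not_mem hT hρ
      have hγ : 0 < |(ρ : ℂ).im| := by linarith
      have hb := norm_integral_zeroTerm_shift_sub_le_high hx0 hh.le ρ hγ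
      rw [← hy] at hb
      have hsplit : y ^ ((ρ : ℂ).re + 2) = y ^ 3 * y ^ ((ρ : ℂ).re - 1) := by
        rw [show (ρ : ℂ).re + 2 = 3 + ((ρ : ℂ).re - 1) by ring, Real.rpow_add hy0,
          show (3 : ℝ) = ((3 : ℕ) : ℝ) by norm_num, Real.rpow_natCast]
      rw [hsplit] at hb
      calc _ ≤ _ := hb
        _ = _ := by ring
  rw [← hsum.tsum_eq]
  exact tsum_of_norm_bounded (h₁.add h₂) hmaj

/-! ### The main bound -/

/-- **`ψ(x) − x` by second differences, under RH up to height `T`** (Rosser–Schoenfeld's method with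
`m = 2`): for `T ≥ 1`, `x > 1`, `h > 0`, with `y = x + 2h`,
`ψ(x) − x ≤ h − log 2π + √y · ∑_{|Im ρ| ≤ T} m(ρ)/|ρ| + (4y³/h²) · ∑_{|Im ρ| > T} m(ρ) y^{β−1}/|Im ρ|³
  + x/(2h(x² − 1))`.
From `h²ψ(x) ≤ ∫_x^{x+h}(ψ₁(u+h) − ψ₁(u)) du = h²(x+h) − ∫ Re ΔZ − h² log 2π + ∫ ΔRe E`,
`norm_integral_Zsum_shift_sub_le` and `∫ ΔRe E ≤ hx/(2(x²−1))`.
[cite: RosserSchoenfeld1962, §6 Thms. 27–28 (with RosserSchoenfeld1975, Lemma 8)] -/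
theorem psi_sub_self_le {T x h : ℝ} (hRH : RiemannHypothesisInStripUpTo T) (hT : 1 ≤ T)
    (hx : 1 < x) (hh : 0 < h) :
    ψ x - x ≤ h - Real.log (2 * π) + Real.sqrt (x + 2 * h) * sumInvNorm T +
      4 * (x + 2 * h) ^ 3 / h ^ 2 * wTail T (x + 2 * h) + x / (2 * h * (x ^ 2 - 1)) := by
  have hxh : x ≤ x + h := by linarith
  have hψ := sq_mul_psi_le (x := x) hh
  have hE := integral_re_psiOneRemainder_shift_sub_le hx hh
  have hZ := norm_integral_Zsum_shift_sub_le hRH hT hx.le hh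
  rw [integral_psiOne_shift_sub_eq hx hh] at hψ
  -- `|∫ Re ΔZ| ≤ ‖∫ ΔZ‖`
  have hint : IntervalIntegrable (fun u : ℝ ↦ Zsum (u + h) - Zsum u) volume x (x + h) := by
    refine ContinuousOn.intervalIntegrable ?_
    rw [uIcc_of_le hxh]
    have h1 : ContinuousOn (fun u : ℝ ↦ Zsum (u + h)) (Icc x (x + h)) :=
      continuousOn_Zsum.comp (continuous_id.add continuous_const).continuousOn fun u hu ↦ by
        simp only [mem_Ici]; linarith [hu.1]
    exact h1.sub (continuousOn_Zsum.mono fun u hu ↦ hx.le.trans hu.1)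
  have hre : ∫ u in x..x + h, (Zsum (u + h) - Zsum u).re = (∫ u in x..x + h, (Zsum (u + h) - Zsum u)).re := by
    have h := Complex.reCLM.intervalIntegral_comp_comm hint
    simpa only [Complex.reCLM_apply] using h
  have habs : -(∫ u in x..x + h, (Zsum (u + h) - Zsum u).re) ≤
      h ^ 2 * Real.sqrt (x + 2 * h) * sumInvNorm T + 4 * (x + 2 * h) ^ 3 * wTail T (x + 2 * h) := by
    rw [hre]
    exact ((neg_le_abs _).trans (Complex.abs_re_le_norm _)).trans hZ
  -- divide by `h²`
  have hh2 : 0 < h ^ 2 := pow_pos hh 2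
  have hx21 : 0 < x ^ 2 - 1 := by nlinarith
  have hmain : h ^ 2 * ψ x ≤ h ^ 2 * (x + h) + (h ^ 2 * Real.sqrt (x + 2 * h) * sumInvNorm T +
      4 * (x + 2 * h) ^ 3 * wTail T (x + 2 * h)) - h ^ 2 * Real.log (2 * π) + h * (x / (2 * (x ^ 2 - 1))) := by
    linarith
  have hdiv : ψ x ≤ (h ^ 2 * (x + h) + (h ^ 2 * Real.sqrt (x + 2 * h) * sumInvNorm T +
      4 * (x + 2 * h) ^ 3 * wTail T (x + 2 * h)) - h ^ 2 * Real.log (2 * π) + h * (x / (2 * (x ^ 2 - 1)))) / h ^ 2 := by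
    rw [le_div_iff₀ hh2]; linarith
  rw [sub_le_iff_le_add]
  refine hdiv.trans_eq ?_
  field_simp
  ring

end PsiSecondDifference

end Literature.NumberTheory.LFunctions

end
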